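import Summits.HubbardSuperconductivity.HubbardSuperconductivity.Theses.HyperoctahedralMott
import Literature.MathematicalPhysics.QuantumLattice.OnSitePairingAlgebra

/-!
# Route `HyperoctahedralMott`, support `DoublonHoppingCubic` (item stmt-HubbardSuperconductivity-6676)

Card D2, "`T₀` is a polynomial in the signed transposition": for two distinct sites `x ≠ y` of any
finite lattice `Λ`, the doublon-number-conserving part of the bond hopping,
`T₀ = Σ_σ [n_{xσ̄} n_{yσ̄} + (1 − n_{xσ̄})(1 − n_{yσ̄})] · (c†_{xσ} c_{yσ} + c†_{yσ} c_{xσ})`,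
equals `(4h − h³)/3` where `h = Σ_σ (c†_{xσ} c_{yσ} + h.c.)` is the full bond hopping
(spectrum `{0, ±1, ±2}`; `(4h − h³)/3` is the Lagrange interpolation of `sin(πh/2)`).

Proof (CAR algebra on the four orbitals `(x,σ)`, `(y,σ)`): for one spin species the bond hopping
`h_σ = c†_a c_b + c†_b c_a` (`a ≠ b`) satisfies `h_σ² = m_σ := n_a + n_b − 2 n_a n_b` (the
single-occupancy indicator of the `σ`-bond) and `h_σ m_σ = h_σ`; the two species commute with each
other and with the other species' number operators; hence
`h³ = h_↑ + h_↓ + 3 m_↑ h_↓ + 3 m_↓ h_↑`, while `n n' + (1 − n)(1 − n') = 1 − m`, so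
`T₀ = (1 − m_↓) h_↑ + (1 − m_↑) h_↓ = (4h − h³)/3`. MacDonald–Girvin–Yoshioka, PRB 37 (1988) 9753
(the `t/U` expansion and its `T₀, T_{±1}`); Essler et al. (2005) §2.1 for the CAR. [folklore]
-/

-- the mandated namespace `Summit.<Summit>.<Problem>.Theorems` repeats `HubbardSuperconductivity`
-- (single-problem summit, D-0017), which the `dupNamespace` linter flags on every declaration
set_option linter.dupNamespace false

noncomputable section

namespace Summit.HubbardSuperconductivity.HubbardSuperconductivity.Theorems.HyperoctahedralMott

open Matrix Literature.MathematicalPhysics.QuantumLattice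

/-! ### One spin species: the bond hopping `c†_a c_b + c†_b c_a` of two distinct orbitals -/

section Orbitals

variable {ι : Type*} [LinearOrder ι] [Fintype ι]

/-- `(c†_a c_b)² = 0` for `a ≠ b`. [folklore] -/
theorem hopTerm_mul_self {a b : ι} (hab : a ≠ b) :
    creation a * annihilation b * (creation a * annihilation b) = 0 := by
  calc creation a * annihilation b * (creation a * annihilation b)
      = creation a * (annihilation b * creation a) * annihilation b := by simp only [mul_assoc]
    _ = creation a * (-(creation a * annihilation b)) * annihilation b := by
        rw [annihilation_mul_creation, if_neg (Ne.symm hab), zero_sub]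
    _ = -(creation a * creation a * (annihilation b * annihilation b)) := by
        simp only [mul_neg, neg_mul, mul_assoc]
    _ = 0 := by rw [creation_mul_self, zero_mul, neg_zero]

/-- `c†_a c_b c†_b c_a = n_a − n_a n_b` for `a ≠ b`. [folklore] -/
theorem hopTerm_mul_hopTerm_swap {a b : ι} (hab : a ≠ b) :
    creation a * annihilation b * (creation b * annihilation a) =
      numberAt a - numberAt a * numberAt b := by
  have hcomm : creation a * numberAt b = numberAt b * creation a :=
    (number_mul_creation_of_ne (Ne.symm hab)).symm
  calc creation a * annihilation b * (creation b * annihilation a)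
      = creation a * (annihilation b * creation b) * annihilation a := by simp only [mul_assoc]
    _ = creation a * (1 - numberAt b) * annihilation a := by
        rw [annihilation_mul_creation, if_pos rfl, numberAt]
    _ = numberAt a - creation a * numberAt b * annihilation a := by
        rw [mul_sub, mul_one, sub_mul]
        rfl
    _ = numberAt a - numberAt a * numberAt b := by
        rw [hcomm, mul_assoc, ← numberAt, (numberAt_commute b a).eq]

/-- **`h_σ² = m_σ`**: `(c†_a c_b + c†_b c_a)² = n_a + n_b − 2 n_a n_b`, the single-occupancy
indicator of the bond, for `a ≠ b`. [folklore] -/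
theorem bondHop_mul_self {a b : ι} (hab : a ≠ b) :
    (creation a * annihilation b + creation b * annihilation a) *
        (creation a * annihilation b + creation b * annihilation a) =
      numberAt a + numberAt b - (numberAt a * numberAt b + numberAt a * numberAt b) := by
  rw [add_mul, mul_add, mul_add, hopTerm_mul_self hab, hopTerm_mul_self (Ne.symm hab),
    hopTerm_mul_hopTerm_swap hab, hopTerm_mul_hopTerm_swap (Ne.symm hab),
    (numberAt_commute b a).eq]
  abel

/-- **`h_σ m_σ = h_σ`**: the bond hopping acts inside the singly-occupied bond subspace,
`(c†_a c_b + c†_b c_a)(n_a + n_b − 2 n_a n_b) = c†_a c_b + c†_b c_a` (`a ≠ b`). [folklore] -/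
theorem bondHop_mul_single {a b : ι} (hab : a ≠ b) :
    (creation a * annihilation b + creation b * annihilation a) *
        (numberAt a + numberAt b - (numberAt a * numberAt b + numberAt a * numberAt b)) =
      creation a * annihilation b + creation b * annihilation a := by
  -- `c†_a c_b n_a = 0`, `c†_a c_b n_b = c†_a c_b`, and the mirror images
  have hA1 : creation a * annihilation b * numberAt a = 0 := by
    rw [mul_assoc, ← numberAt_mul_annihilation_of_ne hab, ← mul_assoc, numberAt,
      creation_mul_number_self, zero_mul]
  have hA2 : creation a * annihilation b * numberAt b = creation a * annihilation b := by
    rw [mul_assoc, annihilation_mul_numberAt_self]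
  have hB1 : creation b * annihilation a * numberAt a = creation b * annihilation a := by
    rw [mul_assoc, annihilation_mul_numberAt_self]
  have hB2 : creation b * annihilation a * numberAt b = 0 := by
    rw [mul_assoc, ← numberAt_mul_annihilation_of_ne (Ne.symm hab), ← mul_assoc, numberAt,
      creation_mul_number_self, zero_mul]
  have hA3 : creation a * annihilation b * (numberAt a * numberAt b) = 0 := by
    rw [← mul_assoc, hA1, zero_mul]
  have hB3 : creation b * annihilation a * (numberAt a * numberAt b) = 0 := by
    rw [← mul_assoc, hB1, hB2]
  simp only [add_mul, mul_add, mul_sub, hA1, hA2, hA3, hB1, hB2, hB3]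
  abel

/-- A fermion bilinear `c†_a c_b` commutes with `c†_c c_d` when the orbital pairs are disjoint.
[folklore] -/
theorem hopTerm_commute_of_disjoint {a b c d : ι} (hbc : b ≠ c) (had : a ≠ d) :
    Commute (creation a * annihilation b) (creation c * annihilation d) := by
  have h := LiebThm1.creation_mul_annihilation_commutator a b c d
  rw [if_neg hbc, if_neg had, sub_zero] at h
  exact sub_eq_zero.mp h

/-- The bond hopping `c†_a c_b + c†_b c_a` commutes with the number operator of a third orbital.
[folklore] -/
theorem bondHop_commute_numberAt {a b c : ι} (hac : a ≠ c) (hbc : b ≠ c) :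
    Commute (creation a * annihilation b + creation b * annihilation a) (numberAt c) :=
  (hopTerm_commute_of_disjoint hbc hac).add_left (hopTerm_commute_of_disjoint hac hbc)

/-- Two bond hoppings on disjoint orbital pairs commute. [folklore] -/
theorem bondHop_commute_bondHop {a b a' b' : ι} (haa' : a ≠ a') (hab' : a ≠ b') (hba' : b ≠ a')
    (hbb' : b ≠ b') :
    Commute (creation a * annihilation b + creation b * annihilation a)
      (creation a' * annihilation b' + creation b' * annihilation a') :=
  ((hopTerm_commute_of_disjoint hba' hab').add_right (hopTerm_commute_of_disjoint hbb' haa')).add_left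
    ((hopTerm_commute_of_disjoint haa' hbb').add_right (hopTerm_commute_of_disjoint hab' hba'))

/-- **The doublon-conserving hopping is `(4h − h³)/3`, orbital form.** For four pairwise distinct
orbitals `a, b` (one spin species on the bond) and `a', b'` (the other), with
`h = (c†_a c_b + c†_b c_a) + (c†_{a'} c_{b'} + c†_{b'} c_{a'})`,
`[n_{a'} n_{b'} + (1 − n_{a'})(1 − n_{b'})](c†_a c_b + h.c.) + [n_a n_b + (1 − n_a)(1 − n_b)](c†_{a'} c_{b'} + h.c.)
= (1/3)(4h − h³)`. [folklore] -/
theorem doublonHopping_cubic_orb {a b a' b' : ι} (hab : a ≠ b) (ha'b' : a' ≠ b') (haa' : a ≠ a')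
    (hab' : a ≠ b') (hba' : b ≠ a') (hbb' : b ≠ b') :
    (numberAt a' * numberAt b' + (1 - numberAt a') * (1 - numberAt b')) *
          (creation a * annihilation b + creation b * annihilation a) +
        (numberAt a * numberAt b + (1 - numberAt a) * (1 - numberAt b)) *
          (creation a' * annihilation b' + creation b' * annihilation a') =
      (1 / 3 : ℂ) • ((4 : ℂ) • ((creation a * annihilation b + creation b * annihilation a) +
          (creation a' * annihilation b' + creation b' * annihilation a')) -
        ((creation a * annihilation b + creation b * annihilation a) +
            (creation a' * annihilation b' + creation b' * annihilation a')) *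
          ((creation a * annihilation b + creation b * annihilation a) +
            (creation a' * annihilation b' + creation b' * annihilation a')) *
          ((creation a * annihilation b + creation b * annihilation a) +
            (creation a' * annihilation b' + creation b' * annihilation a'))) := by
  set h₀ := creation a * annihilation b + creation b * annihilation a with hh₀
  set h₁ := creation a' * annihilation b' + creation b' * annihilation a' with hh₁
  set m₀ := numberAt a + numberAt b - (numberAt a * numberAt b + numberAt a * numberAt b) with hm₀
  set m₁ := numberAt a' + numberAt b' - (numberAt a' * numberAt b' + numberAt a' * numberAt b')
    with hm₁
  -- the one-species relations
  have q1 : h₀ * h₀ = m₀ := bondHop_mul_self hab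
  have q1' : h₁ * h₁ = m₁ := bondHop_mul_self ha'b'
  have q2 : h₀ * m₀ = h₀ := bondHop_mul_single hab
  have q2' : h₁ * m₁ = h₁ := bondHop_mul_single ha'b'
  -- the two species commute with each other and with the other species' number operators
  have q3 : h₁ * h₀ = h₀ * h₁ := (bondHop_commute_bondHop haa' hab' hba' hbb').eq.symm
  have c0 : Commute h₁ m₀ := by
    have ca : Commute h₁ (numberAt a) := bondHop_commute_numberAt (Ne.symm haa') (Ne.symm hab')
    have cb : Commute h₁ (numberAt b) := bondHop_commute_numberAt (Ne.symm hba') (Ne.symm hbb')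
    exact (ca.add_right cb).sub_right ((ca.mul_right cb).add_right (ca.mul_right cb))
  have c1 : Commute h₀ m₁ := by
    have ca : Commute h₀ (numberAt a') := bondHop_commute_numberAt haa' hba'
    have cb : Commute h₀ (numberAt b') := bondHop_commute_numberAt hab' hbb'
    exact (ca.add_right cb).sub_right ((ca.mul_right cb).add_right (ca.mul_right cb))
  have q4 : h₁ * m₀ = m₀ * h₁ := c0.eq
  have q4' : h₀ * m₁ = m₁ * h₀ := c1.eq
  -- the eight monomials of `h³`
  have t1 : h₀ * (h₀ * h₀) = h₀ := by rw [q1, q2]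
  have t2 : h₀ * (h₀ * h₁) = m₀ * h₁ := by rw [← mul_assoc, q1]
  have t3 : h₀ * (h₁ * h₀) = m₀ * h₁ := by rw [q3, ← mul_assoc, q1]
  have t4 : h₀ * (h₁ * h₁) = m₁ * h₀ := by rw [q1', q4']
  have t5 : h₁ * (h₀ * h₀) = m₀ * h₁ := by rw [q1, q4]
  have t6 : h₁ * (h₀ * h₁) = m₁ * h₀ := by rw [← mul_assoc, q3, mul_assoc, q1', q4']
  have t7 : h₁ * (h₁ * h₀) = m₁ * h₀ := by rw [← mul_assoc, q1']
  have t8 : h₁ * (h₁ * h₁) = h₁ := by rw [q1', q2']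
  have hcube : (h₀ + h₁) * (h₀ + h₁) * (h₀ + h₁) =
      h₀ * (h₀ * h₀) + h₀ * (h₀ * h₁) + h₀ * (h₁ * h₀) + h₀ * (h₁ * h₁) +
        (h₁ * (h₀ * h₀) + h₁ * (h₀ * h₁) + h₁ * (h₁ * h₀) + h₁ * (h₁ * h₁)) := by
    noncomm_ring
  -- the projectors `n n' + (1 − n)(1 − n') = 1 − m`
  have hP : numberAt a * numberAt b + (1 - numberAt a) * (1 - numberAt b) = 1 - m₀ := by
    rw [hm₀]; noncomm_ring
  have hP' : numberAt a' * numberAt b' + (1 - numberAt a') * (1 - numberAt b') = 1 - m₁ := by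
    rw [hm₁]; noncomm_ring
  clear_value h₀ h₁ m₀ m₁
  rw [hP, hP', hcube, t1, t2, t3, t4, t5, t6, t7, t8]
  have e1 : (1 - m₁) * h₀ = h₀ - m₁ * h₀ := by rw [sub_mul, one_mul]
  have e2 : (1 - m₀) * h₁ = h₁ - m₀ * h₁ := by rw [sub_mul, one_mul]
  rw [e1, e2]
  module

end Orbitals

/-- **`DoublonHoppingCubic`** (route `HyperoctahedralMott`, item stmt-HubbardSuperconductivity-6676):
for distinct sites `x ≠ y`, the doublon-number-conserving bond hopping `T₀` equals `(4h − h³)/3`,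
`h = Σ_σ (c†_{xσ} c_{yσ} + c†_{yσ} c_{xσ})`. [folklore] -/
theorem doublonHoppingCubic_proof :
    Summit.HubbardSuperconductivity.HubbardSuperconductivity.Theses.HyperoctahedralMott.DoublonHoppingCubic := by
  intro Λ _ _ x y hxy
  dsimp only
  rw [Fin.sum_univ_two, Fin.sum_univ_two]
  simp only [sub_zero, sub_self]
  have hab : orb x 0 ≠ orb y 0 := by rw [Ne, orb_eq_orb_iff]; simp [hxy]
  have ha'b' : orb x 1 ≠ orb y 1 := by rw [Ne, orb_eq_orb_iff]; simp [hxy]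
  have haa' : orb x 0 ≠ orb x 1 := by rw [Ne, orb_eq_orb_iff]; simp
  have hab' : orb x 0 ≠ orb y 1 := by rw [Ne, orb_eq_orb_iff]; simp [hxy]
  have hba' : orb y 0 ≠ orb x 1 := by rw [Ne, orb_eq_orb_iff]; simp [Ne.symm hxy]
  have hbb' : orb y 0 ≠ orb y 1 := by rw [Ne, orb_eq_orb_iff]; simp
  exact doublonHopping_cubic_orb hab ha'b' haa' hab' hba' hbb'

end Summit.HubbardSuperconductivity.HubbardSuperconductivity.Theorems.HyperoctahedralMott

end
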